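import Literature.NumberTheory.LFunctions.SiegelZeroExceptionalPrimes
import Literature.NumberTheory.LFunctions.ZetaMulHarmonicMean
import Literature.NumberTheory.LFunctions.ExceptionalPrimesCombinatorics
import Literature.NumberTheory.LFunctions.RealCharacterDivisorSums
import Literature.NumberTheory.LFunctions.SiegelTheorem
import Literature.NumberTheory.LFunctions.ExceptionalZeroLogDerivOne
import Mathlib.Analysis.SpecialFunctions.Pow.Asymptotics
import HarnessLib

/-!
# Proof of Tao–Teräväinen's Proposition 3.5, first bound (3.13):
# `∑_{q^{(1+ε)/2} < p* ≤ x} 1/p* ≪_ε (log_q x)/η`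

Topic `Literature/NumberTheory/LFunctions`, namespace `SiegelZero`. Everything in this file is
PROVED; the main result `TaoTeravainen2021_eq313_holds` DISCHARGES the named fact
`Literature.NumberTheory.LFunctions.SiegelZero.TaoTeravainen2021_eq313` of
`SiegelZeroExceptionalPrimes.lean` (Tao–Teräväinen, J. London Math. Soc. 106 (2022),
Proposition 3.5, (3.13), for an arbitrary primitive quadratic character).

We follow the printed proof (arXiv:2109.06291, §3.3, p. 10–11) with the tree's inputs:

* "from [MV]", `∑_{n ≤ x} (1∗χ)(n)/n = (log x + γ) L(1,χ) + L'(1,χ) + O_ε(q^{-ε/10})` for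
  `x ≥ q^{(1+ε)/2}`: the hyperbola-method mean value
  `Literature.NumberTheory.LFunctions.ZetaMulHarmonic.abs_sum_zetaMul_re_div_sub_le` with the
  Pólya–Vinogradov window bound `W = √q (1 + log q)`
  (`Literature.NumberTheory.LFunctions.CharacterTails.norm_window_le_polyaVinogradov`) and the cut
  `y₀ = ⌊√(W Y)⌋`, `Y = ⌊q^{(1+ε)/2}⌋` (`abs_sub_main_le_of_cut`);
* "From Siegel's theorem we have `L(1,χ) ≫_ε q^{-ε/10}`":
  `Literature.NumberTheory.LFunctions.Siegel.siegel_theorem_primitive` (with exponent `ε/16`);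
* "`(L'/L)(1,χ) ≍ η log q`":
  `Literature.NumberTheory.LFunctions.ExceptionalZero.exists_abs_sub_le_div_eta`, giving
  `L'(1,χ) ≥ ½ L(1,χ) η log q` once `η ≥ 2C`;
* "the non-negativity and multiplicativity of `1∗χ`", in the rigorous form
  `G(Y)(1 + ∑_{Y<p≤Z} g(p)) ≤ G(YZ)` for the multiplicative weight `g(n) = (1∗χ)(n)/n ≥ 0`:
  `Literature.NumberTheory.LFunctions.SiegelZero.sum_Icc_mul_one_add_sum_prime_le`, together with
  `g(p*) ≥ 1/p*` at exceptional primes (`sum_mul_sum_excPrimes_le`).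

With `S(N) = ∑_{n ≤ N} (1∗χ)(n)/n`, `s = √(W/Y)` and `x₁ = ⌊x⌋` these give, for `q` large in
terms of `ε` (`exists_threshold`): `S(Y) ≥ L'(1,χ) − E₀ ≥ ¼ L(1,χ) η log q` and
`S(Y x₁) − S(Y) ≤ L(1,χ) log x₁ + 2E₀ + 3s log x₁ ≤ 3 L(1,χ) log x`
(`E₀ ≤ ¼ L(1,χ) log q` and `3s ≤ L(1,χ)` being the two places where Siegel's theorem enters),
whence `∑_{Y < p* ≤ x₁} 1/p* ≤ (S(Yx₁) − S(Y))/S(Y) ≤ 12 (log x/log q)/η`. Conductors below the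
threshold are excluded by taking `η₀` large: a fixed `L(s, χ)` has no zeros in some
neighbourhood of `1` (`exists_eta_forall_LFunction_ne_zero`; this is the source's "we will also
assume that `η` is sufficiently large depending on the fixed quantities"). The constant is
ineffective exactly as in print (through Siegel's theorem).

## References

* T. Tao, J. Teräväinen, *The Hardy–Littlewood–Chowla conjecture in the presence of a Siegel
  zero*, J. London Math. Soc. (2) 106 (2022), Proposition 3.5 and its proof. [TaoTeravainen2021]
* H. L. Montgomery, R. C. Vaughan, *Multiplicative Number Theory I*, CUP 2007, §11.2
  (Thm. 11.14 Siegel; Exercise 11.2.1.3). [MontgomeryVaughan2007]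
-/

noncomputable section

open Finset Filter Topology
open Literature.NumberTheory.LFunctions.DirichletAbel

namespace Literature.NumberTheory.LFunctions.SiegelZero

/-! ### Small conductors: no zeros near `1` -/

/-- **A fixed `L(s, χ)` has no real zeros close to `1`, uniformly over conductors `q ≤ Q`**:
there is `η₁` such that `L(1 − 1/(η log q), χ) ≠ 0` for all `q ≤ Q`, all `χ ≠ χ₀` mod `q` and all
`η ≥ η₁` (finitely many characters, each non-vanishing and continuous at `1`). [folklore] -/
theorem exists_eta_forall_LFunction_ne_zero (Q : ℕ) :
    ∃ η₁ : ℝ, ∀ (q : ℕ) [NeZero q], q ≤ Q → ∀ χ : DirichletCharacter ℂ q, χ ≠ 1 →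
      ∀ η : ℝ, η₁ ≤ η → χ.LFunction ((1 - 1 / (η * Real.log q) : ℝ) : ℂ) ≠ 0 := by
  induction Q with
  | zero =>
    refine ⟨0, fun q _ hq χ _ η _ => ?_⟩
    have := NeZero.ne q
    omega
  | succ Q ih =>
    obtain ⟨η₁, hη₁⟩ := ih
    have key : ∀ χ : DirichletCharacter ℂ (Q + 1), ∃ ηχ : ℝ, χ ≠ 1 → ∀ η : ℝ, ηχ ≤ η →
        χ.LFunction ((1 - 1 / (η * Real.log (Q + 1 : ℕ)) : ℝ) : ℂ) ≠ 0 := by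
      intro χ
      by_cases hχ : χ = 1
      · exact ⟨0, fun h => (h hχ).elim⟩
      rcases Nat.lt_or_ge 1 (Q + 1) with hQ | hQ
      · have hcont : ContinuousAt χ.LFunction 1 :=
          (DirichletCharacter.differentiable_LFunction hχ).continuous.continuousAt
        have hne : χ.LFunction 1 ≠ 0 := DirichletCharacter.LFunction_apply_one_ne_zero hχ
        obtain ⟨δ, hδ, hball⟩ := Metric.eventually_nhds_iff.mp (hcont.eventually_ne hne)
        have hlog : 0 < Real.log (Q + 1 : ℕ) := Real.log_pos (by exact_mod_cast hQ)
        refine ⟨1 / (δ * Real.log (Q + 1 : ℕ)) + 1, fun _ η hη => hball ?_⟩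
        have hη0 : 0 < η := by
          have : 0 < 1 / (δ * Real.log (Q + 1 : ℕ)) := by positivity
          linarith
        set t : ℝ := 1 / (η * Real.log (Q + 1 : ℕ)) with ht
        have ht0 : 0 < t := by positivity
        have htδ : t < δ := by
          rw [ht, div_lt_iff₀ (by positivity)]
          have h1 : 1 / (δ * Real.log (Q + 1 : ℕ)) < η := by linarith
          rw [div_lt_iff₀ (by positivity)] at h1
          nlinarith
        rw [Complex.dist_eq]
        have : (((1 - t : ℝ)) : ℂ) - 1 = ((-t : ℝ) : ℂ) := by push_cast; ring
        rw [this, Complex.norm_real, Real.norm_eq_abs, abs_neg, abs_of_pos ht0]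
        exact htδ
      · exact absurd (DirichletCharacter.level_one' χ (by omega)) hχ
    choose f hf using key
    obtain ⟨M, hM⟩ := Finite.exists_le f
    refine ⟨max η₁ M, fun q _ hq χ hχ η hη => ?_⟩
    rcases Nat.lt_or_ge q (Q + 1) with hlt | hge
    · exact hη₁ q (by omega) χ hχ η ((le_max_left _ _).trans hη)
    · have hqQ : q = Q + 1 := le_antisymm hq hge
      subst hqQ
      exact hf χ hχ η ((hM χ).trans ((le_max_right _ _).trans hη))

/-! ### The weight `g(n) = (1 ∗ χ)(n)/n` and the products with one exceptional prime -/

/-- `Re (1∗χ)(n) = r(n)` (`RealChar.charDivisorSum`) for a quadratic character. [folklore] -/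
theorem zetaMul_re_eq_charDivisorSum {q : ℕ} (χ : DirichletCharacter ℂ q) (hq : χ ^ 2 = 1)
    (n : ℕ) : (χ.zetaMul n).re = RealChar.charDivisorSum χ n := by
  rw [← RealChar.ofReal_charDivisorSum χ hq n, Complex.ofReal_re]

/-- At an exceptional prime `p*` (`χ(p*) ≠ -1`) the weight `(1∗χ)(p*)/p* = (1 + χ(p*))/p*` is at
least `1/p*`. [cite: TaoTeravainen2021, §3.3 proof of Proposition 3.5] -/
theorem one_div_le_zetaMul_re_div {q : ℕ} (χ : DirichletCharacter ℂ q) (hq : χ ^ 2 = 1)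
    {p : ℕ} (hp : p.Prime) (hexc : χ (p : ZMod q) ≠ -1) :
    (1 : ℝ) / p ≤ (χ.zetaMul p).re / p := by
  rw [zetaMul_re_eq_charDivisorSum χ hq, RealChar.charDivisorSum_prime χ hq hp,
    reChar_apply χ hp.ne_zero]
  refine div_le_div_of_nonneg_right ?_ (Nat.cast_nonneg p)
  rcases MulChar.isQuadratic_iff_sq_eq_one.mpr hq (p : ZMod q) with h | h | h
  · rw [h]; simp
  · rw [h]; simp
  · exact absurd h hexc

/-- **"Non-negativity and multiplicativity of `1∗χ`"** (the display before (3.13) in the source,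
with the injectivity supplied by the tree's `sum_Icc_mul_one_add_sum_prime_le`): for a quadratic
`χ` and `1 ≤ Y ≤ x₁`,
`(∑_{n ≤ Y} (1∗χ)(n)/n) · ∑_{Y < p* ≤ x₁} 1/p* ≤ ∑_{Y < n ≤ Y x₁} (1∗χ)(n)/n`.
[cite: TaoTeravainen2021, §3.3 proof of Proposition 3.5] -/
theorem sum_mul_sum_excPrimes_le {q : ℕ} (χ : DirichletCharacter ℂ q) (hq : χ ^ 2 = 1)
    {Y x₁ : ℕ} (hY : 1 ≤ Y) (hYx : Y ≤ x₁) :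
    (∑ n ∈ Icc 1 Y, (χ.zetaMul n).re / n) * ∑ p ∈ excPrimes χ (Ioc Y x₁), (1 : ℝ) / p ≤
      (∑ n ∈ Icc 1 (Y * x₁), (χ.zetaMul n).re / n) - ∑ n ∈ Icc 1 Y, (χ.zetaMul n).re / n := by
  set g : ArithmeticFunction ℝ := ⟨fun n => (χ.zetaMul n).re / n, by simp⟩ with hgdef
  have hg_apply : ∀ n, g n = RealChar.charDivisorSum χ n / n := fun n => by
    simp only [hgdef, ArithmeticFunction.coe_mk, zetaMul_re_eq_charDivisorSum χ hq]
  have hgmul : g.IsMultiplicative := by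
    refine ⟨by rw [hg_apply]; simp, fun {m n} hmn => ?_⟩
    rw [hg_apply, hg_apply, hg_apply,
      (RealChar.isMultiplicative_charDivisorSum χ hq).map_mul_of_coprime hmn, Nat.cast_mul,
      div_mul_div_comm]
  have hg0 : ∀ n, 0 ≤ g n := fun n => by
    rw [hg_apply]
    exact div_nonneg (RealChar.charDivisorSum_nonneg χ hq n) (Nat.cast_nonneg n)
  have hgsum : ∀ N : ℕ, ∑ n ∈ Icc 1 N, g n = ∑ n ∈ Icc 1 N, (χ.zetaMul n).re / n := fun N =>
    Finset.sum_congr rfl fun n _ => rfl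
  have hA := sum_Icc_mul_one_add_sum_prime_le hgmul hg0 hY hYx
  rw [hgsum, hgsum] at hA
  have hexc : ∑ p ∈ excPrimes χ (Ioc Y x₁), (1 : ℝ) / p ≤
      ∑ p ∈ (Ioc Y x₁).filter Nat.Prime, g p := by
    have hsub : excPrimes χ (Ioc Y x₁) ⊆ (Ioc Y x₁).filter Nat.Prime := by
      intro p hp
      rw [mem_excPrimes] at hp
      exact Finset.mem_filter.mpr ⟨hp.1, hp.2.1⟩
    calc ∑ p ∈ excPrimes χ (Ioc Y x₁), (1 : ℝ) / p ≤ ∑ p ∈ excPrimes χ (Ioc Y x₁), g p := by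
          refine Finset.sum_le_sum fun p hp => ?_
          rw [mem_excPrimes] at hp
          simp only [hgdef, ArithmeticFunction.coe_mk]
          exact one_div_le_zetaMul_re_div χ hq hp.2.1 hp.2.2
      _ ≤ _ := Finset.sum_le_sum_of_subset_of_nonneg hsub fun p _ _ => hg0 p
  have hS0 : 0 ≤ ∑ n ∈ Icc 1 Y, (χ.zetaMul n).re / n := by
    rw [← hgsum]; exact Finset.sum_nonneg fun n _ => hg0 n
  calc (∑ n ∈ Icc 1 Y, (χ.zetaMul n).re / n) * ∑ p ∈ excPrimes χ (Ioc Y x₁), (1 : ℝ) / p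
      ≤ (∑ n ∈ Icc 1 Y, (χ.zetaMul n).re / n) * ∑ p ∈ (Ioc Y x₁).filter Nat.Prime, g p :=
        mul_le_mul_of_nonneg_left hexc hS0
    _ ≤ _ := by linarith

/-! ### The mean value with the Pólya–Vinogradov cut -/

/-- **The "[MV]" input with the cut `y₀`**: for a quadratic `χ ≠ χ₀` with window sums bounded by
`W`, naturals `2 ≤ y₀ ≤ Y ≤ N` and a real `s ≥ 0` with `W ≤ s (y₀ + 1)` and `y₀ ≤ s Y`:
`|∑_{n ≤ N} (1∗χ)(n)/n − (L'(1,χ) + (log N + γ) L(1,χ))| ≤ (3 (1 + log N) + 2) s`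
(the tree's `ZetaMulHarmonic.abs_sum_zetaMul_re_div_sub_le`, `3W(1 + log N)/(y₀+1) + 2y₀/N`).
[cite: TaoTeravainen2021, §3.3 proof of Proposition 3.5, first display] -/
theorem abs_sub_main_le_of_cut {q : ℕ} [NeZero q] (χ : DirichletCharacter ℂ q) (hχ : χ ≠ 1)
    (hq : χ ^ 2 = 1) {W : ℝ} (hW : ∀ N n : ℕ, ‖∑ k ∈ Ioc N n, χ (k : ZMod q)‖ ≤ W)
    {y₀ Y N : ℕ} (hy₀ : 2 ≤ y₀) (hy₀Y : y₀ ≤ Y) (hYN : Y ≤ N) {s : ℝ} (hs : 0 ≤ s)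
    (hWs : W ≤ s * (y₀ + 1)) (hys : (y₀ : ℝ) ≤ s * Y) :
    |∑ n ∈ Icc 1 N, (χ.zetaMul n).re / n -
        ((deriv χ.LFunction 1).re +
          (Real.log N + Real.eulerMascheroniConstant) * (χ.LFunction 1).re)| ≤
      (3 * (1 + Real.log N) + 2) * s := by
  have h := ZetaMulHarmonic.abs_sum_zetaMul_re_div_sub_le χ hχ hq hW hy₀ (hy₀Y.trans hYN)
  refine h.trans ?_
  have hN1 : 1 ≤ N := le_trans (by omega) (hy₀Y.trans hYN)
  have hN0 : (0 : ℝ) < N := by exact_mod_cast hN1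
  have hY0 : (0 : ℝ) < Y := by exact_mod_cast (show 0 < Y by omega)
  have hYN' : (Y : ℝ) ≤ N := by exact_mod_cast hYN
  have hlogN : 0 ≤ Real.log N := Real.log_nonneg (by exact_mod_cast hN1)
  have hW0 : 0 ≤ W := le_trans (norm_nonneg _) (hW 0 0)
  have h1 : 3 * W * (1 + Real.log N) / (y₀ + 1) ≤ 3 * (1 + Real.log N) * s := by
    rw [div_le_iff₀ (by positivity)]
    have : 0 ≤ 3 * (1 + Real.log N) := by positivity
    nlinarith
  have h2 : 2 * (y₀ : ℝ) / N ≤ 2 * s := by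
    rw [div_le_iff₀ hN0]
    nlinarith
  nlinarith

/-! ### The threshold in `q` -/

/-- `(1 + log u)² u^{-a} → 0` (`a > 0`). [folklore] -/
theorem tendsto_one_add_log_sq_mul_rpow_neg {a : ℝ} (ha : 0 < a) :
    Tendsto (fun u : ℝ => (1 + Real.log u) ^ 2 * u ^ (-a)) atTop (𝓝 0) := by
  have h1 : Tendsto (fun u : ℝ => Real.log u ^ (2 : ℝ) / u ^ a) atTop (𝓝 0) :=
    (isLittleO_log_rpow_rpow_atTop 2 ha).tendsto_div_nhds_zero
  have h2 : Tendsto (fun u : ℝ => u ^ (-a)) atTop (𝓝 0) := tendsto_rpow_neg_atTop ha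
  have h3 : Tendsto (fun u : ℝ => 2 * (Real.log u ^ (2 : ℝ) / u ^ a) + 2 * u ^ (-a)) atTop
      (𝓝 (2 * 0 + 2 * 0)) := (h1.const_mul 2).add (h2.const_mul 2)
  rw [mul_zero, add_zero] at h3
  refine squeeze_zero' ?_ ?_ h3
  · filter_upwards [eventually_ge_atTop 1] with u hu
    positivity
  · filter_upwards [eventually_ge_atTop 1] with u hu
    have hu0 : 0 < u := by linarith
    rw [Real.rpow_neg hu0.le, div_eq_mul_inv, Real.rpow_two]
    have hi : 0 ≤ (u ^ a)⁻¹ := by positivity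
    nlinarith [sq_nonneg (Real.log u - 1), mul_nonneg (sq_nonneg (Real.log u - 1)) hi]

/-- **The threshold `Q(ε)`**: for `q ≥ Q`, `q^{(1+ε)/2} ≥ 8`, the Pólya–Vinogradov bound
`W = √q (1 + log q)` is at most `q^{(1+ε)/2}/2`, and the two error quantities are dominated by the
Siegel lower bound `C q^{-ε/16}`:
`3√2 (1 + log q) q^{-ε/4} ≤ C q^{-ε/16}` and `5√2 (1+ε)(1 + log q)² q^{-ε/4} ≤ (C/8) q^{-ε/16}`.
[folklore] -/
theorem exists_threshold {ε C : ℝ} (hε : 0 < ε) (hC : 0 < C) :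
    ∃ Q : ℕ, ∀ q : ℕ, Q ≤ q →
      8 ≤ (q : ℝ) ^ ((1 + ε) / 2) ∧
      Real.sqrt q * (1 + Real.log q) ≤ (q : ℝ) ^ ((1 + ε) / 2) / 2 ∧
      3 * Real.sqrt 2 * (1 + Real.log q) * (q : ℝ) ^ (-(ε / 4)) ≤ C * (q : ℝ) ^ (-(ε / 16)) ∧
      5 * Real.sqrt 2 * (1 + ε) * (1 + Real.log q) ^ 2 * (q : ℝ) ^ (-(ε / 4)) ≤
        C / 8 * (q : ℝ) ^ (-(ε / 16)) := by
  set c : ℝ := min (1 / 2) (min (C / (3 * Real.sqrt 2)) (C / (40 * Real.sqrt 2 * (1 + ε))))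
    with hcdef
  have hsq2 : 0 < Real.sqrt 2 := Real.sqrt_pos.mpr two_pos
  have hc0 : 0 < c := by positivity
  have hc1 : c ≤ 1 / 2 := min_le_left _ _
  have hc2 : c ≤ C / (3 * Real.sqrt 2) := (min_le_right _ _).trans (min_le_left _ _)
  have hc3 : c ≤ C / (40 * Real.sqrt 2 * (1 + ε)) := (min_le_right _ _).trans (min_le_right _ _)
  have hT := tendsto_one_add_log_sq_mul_rpow_neg (a := 3 * ε / 16) (by positivity)
  obtain ⟨Q₀, hQ₀⟩ := Filter.eventually_atTop.mp ((tendsto_order.1 hT).2 c hc0)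
  refine ⟨max 64 ⌈Q₀⌉₊, fun q hq => ?_⟩
  have hq64 : 64 ≤ q := le_trans (le_max_left _ _) hq
  have hqQ₀ : Q₀ ≤ q := (Nat.le_ceil Q₀).trans (by exact_mod_cast le_trans (le_max_right _ _) hq)
  have hq0 : (0 : ℝ) < q := by positivity
  have hq1 : (1 : ℝ) ≤ q := by exact_mod_cast (by omega : 1 ≤ q)
  set l : ℝ := Real.log q with hl
  have hl0 : 0 ≤ l := Real.log_nonneg hq1
  have hTq : (1 + l) ^ 2 * (q : ℝ) ^ (-(3 * ε / 16)) ≤ c := (hQ₀ q hqQ₀).le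
  have hpow1 : (q : ℝ) ^ (-(ε / 2)) ≤ (q : ℝ) ^ (-(3 * ε / 16)) :=
    Real.rpow_le_rpow_of_exponent_le hq1 (by linarith)
  have hpow2 : (q : ℝ) ^ (-(ε / 4)) = (q : ℝ) ^ (-(3 * ε / 16)) * (q : ℝ) ^ (-(ε / 16)) := by
    rw [← Real.rpow_add hq0]; ring_nf
  have hqpow : 0 < (q : ℝ) ^ (-(ε / 16)) := Real.rpow_pos_of_pos hq0 _
  have hyr8 : 8 ≤ (q : ℝ) ^ ((1 + ε) / 2) := by
    have h1 : (q : ℝ) ^ ((1 : ℝ) / 2) ≤ (q : ℝ) ^ ((1 + ε) / 2) :=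
      Real.rpow_le_rpow_of_exponent_le hq1 (by linarith)
    have h2 : (8 : ℝ) ≤ (q : ℝ) ^ ((1 : ℝ) / 2) := by
      rw [← Real.sqrt_eq_rpow, show (8 : ℝ) = Real.sqrt 64 by
        rw [show (64 : ℝ) = 8 ^ 2 by norm_num, Real.sqrt_sq (by norm_num)]]
      exact Real.sqrt_le_sqrt (by exact_mod_cast hq64)
    linarith
  refine ⟨hyr8, ?_, ?_, ?_⟩
  · -- `W = (1 + l) q^{-ε/2} · q^{(1+ε)/2} ≤ c q^{(1+ε)/2}`
    have hWeq : Real.sqrt q * (1 + l) =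
        (1 + l) * (q : ℝ) ^ (-(ε / 2)) * (q : ℝ) ^ ((1 + ε) / 2) := by
      rw [Real.sqrt_eq_rpow, mul_assoc, ← Real.rpow_add hq0]
      ring_nf
    rw [hWeq]
    have h1 : (1 + l) * (q : ℝ) ^ (-(ε / 2)) ≤ c :=
      le_trans (mul_le_mul (by nlinarith : (1 + l) ≤ (1 + l) ^ 2) hpow1 (by positivity)
        (by positivity)) hTq
    have h2 : 0 ≤ (q : ℝ) ^ ((1 + ε) / 2) := by positivity
    nlinarith [mul_le_mul_of_nonneg_right h1 h2]
  · calc 3 * Real.sqrt 2 * (1 + l) * (q : ℝ) ^ (-(ε / 4))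
        ≤ 3 * Real.sqrt 2 * ((1 + l) ^ 2 * (q : ℝ) ^ (-(3 * ε / 16))) * (q : ℝ) ^ (-(ε / 16)) := by
          rw [hpow2]
          have h1 : (1 + l) ≤ (1 + l) ^ 2 := by nlinarith
          have h2 : 0 ≤ (q : ℝ) ^ (-(3 * ε / 16)) * (q : ℝ) ^ (-(ε / 16)) := by positivity
          nlinarith [mul_le_mul_of_nonneg_right h1 h2]
      _ ≤ 3 * Real.sqrt 2 * c * (q : ℝ) ^ (-(ε / 16)) := by gcongr
      _ ≤ C * (q : ℝ) ^ (-(ε / 16)) := by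
          refine mul_le_mul_of_nonneg_right ?_ hqpow.le
          rw [le_div_iff₀ (by positivity)] at hc2
          linarith
  · calc 5 * Real.sqrt 2 * (1 + ε) * (1 + l) ^ 2 * (q : ℝ) ^ (-(ε / 4))
        = 5 * Real.sqrt 2 * (1 + ε) * ((1 + l) ^ 2 * (q : ℝ) ^ (-(3 * ε / 16))) *
            (q : ℝ) ^ (-(ε / 16)) := by rw [hpow2]; ring
      _ ≤ 5 * Real.sqrt 2 * (1 + ε) * c * (q : ℝ) ^ (-(ε / 16)) := by gcongr
      _ ≤ C / 8 * (q : ℝ) ^ (-(ε / 16)) := by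
          refine mul_le_mul_of_nonneg_right ?_ hqpow.le
          rw [le_div_iff₀ (by positivity)] at hc3
          linarith

/-- `√(W/Y) ≤ √2 (1 + log q) q^{-ε/4}` for `W = √q (1 + log q)` and `Y ≥ q^{(1+ε)/2}/2`. [folklore] -/
theorem sqrt_window_div_le {q : ℕ} (hq : 1 ≤ q) (ε : ℝ) {Y : ℝ}
    (hY : (q : ℝ) ^ ((1 + ε) / 2) / 2 ≤ Y) :
    Real.sqrt (Real.sqrt q * (1 + Real.log q) / Y) ≤
      Real.sqrt 2 * (1 + Real.log q) * (q : ℝ) ^ (-(ε / 4)) := by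
  have hq0 : (0 : ℝ) < q := by exact_mod_cast hq
  have hq1 : (1 : ℝ) ≤ q := by exact_mod_cast hq
  set l : ℝ := Real.log q with hl
  have hl0 : 0 ≤ l := Real.log_nonneg hq1
  have hyr0 : 0 < (q : ℝ) ^ ((1 + ε) / 2) := by positivity
  have hWyr : Real.sqrt q * (1 + l) / (q : ℝ) ^ ((1 + ε) / 2) = (1 + l) * (q : ℝ) ^ (-(ε / 2)) := by
    rw [Real.sqrt_eq_rpow, div_eq_iff hyr0.ne',
      show (1 + l) * (q : ℝ) ^ (-(ε / 2)) * (q : ℝ) ^ ((1 + ε) / 2) =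
        (1 + l) * ((q : ℝ) ^ (-(ε / 2)) * (q : ℝ) ^ ((1 + ε) / 2)) by ring,
      ← Real.rpow_add hq0, show -(ε / 2) + (1 + ε) / 2 = (1 : ℝ) / 2 by ring]
    ring
  have h1 : Real.sqrt q * (1 + l) / Y ≤ 2 * (1 + l) * (q : ℝ) ^ (-(ε / 2)) := by
    calc Real.sqrt q * (1 + l) / Y ≤ Real.sqrt q * (1 + l) / ((q : ℝ) ^ ((1 + ε) / 2) / 2) :=
          div_le_div_of_nonneg_left (by positivity) (by positivity) hY
      _ = 2 * (Real.sqrt q * (1 + l) / (q : ℝ) ^ ((1 + ε) / 2)) := by field_simp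
      _ = 2 * (1 + l) * (q : ℝ) ^ (-(ε / 2)) := by rw [hWyr]; ring
  refine (Real.sqrt_le_sqrt h1).trans ?_
  have h3 : Real.sqrt (2 * (1 + l) * (q : ℝ) ^ (-(ε / 2))) =
      Real.sqrt 2 * Real.sqrt (1 + l) * (q : ℝ) ^ (-(ε / 4)) := by
    rw [Real.sqrt_mul (by positivity), Real.sqrt_mul (by norm_num),
      Real.sqrt_eq_rpow ((q : ℝ) ^ _), ← Real.rpow_mul hq0.le]
    ring_nf
  rw [h3]
  have h4 : Real.sqrt (1 + l) ≤ 1 + l := by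
    rw [Real.sqrt_le_left (by linarith)]
    nlinarith
  have : 0 ≤ Real.sqrt 2 * (q : ℝ) ^ (-(ε / 4)) := by positivity
  nlinarith

/-- `√(WY) = √(W/Y) · Y` and `W = √(W/Y) · √(WY)` for `W, Y > 0`. [folklore] -/
theorem sqrt_mul_facts {W Y : ℝ} (hW : 0 < W) (hY : 0 < Y) :
    Real.sqrt (W * Y) = Real.sqrt (W / Y) * Y ∧
      W = Real.sqrt (W / Y) * Real.sqrt (W * Y) := by
  have hsW := Real.sqrt_pos.mpr hW
  have hsY := Real.sqrt_pos.mpr hY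
  rw [Real.sqrt_mul hW.le, Real.sqrt_div hW.le]
  constructor
  · rw [div_mul_eq_mul_div, eq_div_iff hsY.ne', mul_assoc, Real.mul_self_sqrt hY.le]
  · field_simp
    rw [Real.sq_sqrt hW.le]

/-! ### Proposition 3.5 (3.13) -/

/-- **Tao–Teräväinen 2022, Proposition 3.5, first bound (3.13) — discharged.** For every `ε > 0`
there are `K, η₀` such that for every primitive quadratic `χ` mod `q`, every `η ≥ η₀` with
`L(1 − 1/(η log q), χ) = 0` and every real `x ≥ q^{(1+ε)/2}`:
`∑_{p* exceptional, q^{(1+ε)/2} < p* ≤ x} 1/p* ≤ K (log x/log q)/η` (with `K = 12`; `η₀` depends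
on `ε`, ineffectively). [cite: TaoTeravainen2021, Proposition 3.5 (3.13)] -/
theorem TaoTeravainen2021_eq313_holds : TaoTeravainen2021_eq313 := by
  intro ε hε
  -- constants: Siegel (exponent ε/16), the `L'/L` comparison, the threshold, small conductors
  obtain ⟨CS, hCS, hSiegel⟩ :=
    Literature.NumberTheory.LFunctions.Siegel.siegel_theorem_primitive (ε := ε / 16) (by positivity)
  obtain ⟨CD, ηD, hCD, hηD, hD⟩ :=
    Literature.NumberTheory.LFunctions.ExceptionalZero.exists_abs_sub_le_div_eta
  obtain ⟨Q, hQ⟩ := exists_threshold hε hCS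
  obtain ⟨η₁, hη₁⟩ := exists_eta_forall_LFunction_ne_zero Q
  refine ⟨12, max (max ηD (2 * CD)) (max 1 η₁), ?_⟩
  intro q _ χ hprim hquad η hη hzero x hx
  -- unpack `η`
  have hηD' : ηD ≤ η := (le_max_left _ _).trans ((le_max_left _ _).trans hη)
  have hηC : 2 * CD ≤ η := (le_max_right _ _).trans ((le_max_left _ _).trans hη)
  have hη1 : 1 ≤ η := (le_max_left _ _).trans ((le_max_right _ _).trans hη)
  have hηη₁ : η₁ ≤ η := (le_max_right _ _).trans ((le_max_right _ _).trans hη)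
  have hη0 : 0 < η := by linarith only [hη1]
  -- the character
  have hq2 : 2 ≤ q := two_le_of_LFunction_eq_zero hzero
  have hsq : χ ^ 2 = 1 := MulChar.isQuadratic_iff_sq_eq_one.mp hquad
  have hne : χ ≠ 1 := CharacterTails.ne_one_of_isPrimitive χ hprim hq2
  -- small conductors are excluded; the threshold facts; Siegel; `L'/L`
  have hqQ : Q ≤ q := by
    by_contra h
    exact hη₁ q (not_le.mp h).le χ hne η hηη₁ hzero
  obtain ⟨hyr8, hWyr, hS1, hS2⟩ := hQ q hqQ
  have hL₁S := hSiegel q χ hsq hprim hne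
  have hDq := hD q χ hne hsq hq2 η hηD' hzero
  have hq0 : (0 : ℝ) < q := by positivity
  have hq1 : (1 : ℝ) ≤ q := by exact_mod_cast (by omega : 1 ≤ q)
  set l : ℝ := Real.log q with hl
  set L₁ : ℝ := (χ.LFunction 1).re with hL₁def
  set M₁ : ℝ := (deriv χ.LFunction 1).re with hM₁def
  have hl2 : Real.log 2 ≤ l := Real.log_le_log two_pos (by exact_mod_cast hq2)
  have hlhalf : 1 / 2 < l := lt_of_lt_of_le (by have := Real.log_two_gt_d9; linarith) hl2
  have hl0 : 0 < l := by linarith only [hlhalf]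
  -- `L₁ = L(1,χ) ≥ CS q^{-ε/16} > 0`, `M₁ = L'(1,χ) ≥ ½ L₁ η log q`
  have hqpow : 0 < (q : ℝ) ^ (-(ε / 16)) := Real.rpow_pos_of_pos hq0 _
  have hL₁0 : 0 < L₁ := lt_of_lt_of_le (mul_pos hCS hqpow) hL₁S
  have hM₁ : L₁ * η * l / 2 ≤ M₁ := by
    have h' := (abs_le.mp hDq).1
    have hCDη : CD / η * L₁ ≤ L₁ / 2 := by
      rw [div_mul_eq_mul_div, div_le_div_iff₀ hη0 two_pos]
      have := mul_le_mul_of_nonneg_left hηC hL₁0.le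
      linarith only [this]
    have hkey : L₁ / 2 ≤ 1 / (η * l) * M₁ := by linarith only [h', hCDη]
    rw [div_mul_eq_mul_div, one_mul, le_div_iff₀ (by positivity)] at hkey
    linarith only [hkey]
  -- `Y = ⌊q^{(1+ε)/2}⌋`, `x₁ = ⌊x⌋`
  set yr : ℝ := (q : ℝ) ^ ((1 + ε) / 2) with hyr
  set Y : ℕ := ⌊yr⌋₊ with hYdef
  set x₁ : ℕ := ⌊x⌋₊ with hx₁def
  have hyr0 : 0 < yr := by linarith only [hyr8]
  have hYle : (Y : ℝ) ≤ yr := Nat.floor_le hyr0.le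
  have hYgt : yr - 1 < Y := by
    have := Nat.lt_floor_add_one yr
    rw [← hYdef] at this; linarith only [this]
  have hYhalf : yr / 2 ≤ Y := by linarith only [hYgt, hyr8]
  have hY4 : (4 : ℝ) ≤ Y := by linarith only [hYhalf, hyr8]
  have hY1 : 1 ≤ Y := by exact_mod_cast (by linarith only [hY4] : (1 : ℝ) ≤ Y)
  have hYr0 : (0 : ℝ) < Y := by linarith only [hY4]
  have hxyr : yr ≤ x := hx
  have hx1le : (x₁ : ℝ) ≤ x := Nat.floor_le (by linarith only [hxyr, hyr0])
  have hYx₁ : Y ≤ x₁ := Nat.floor_le_floor hxyr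
  have hx₁1 : 1 ≤ x₁ := hY1.trans hYx₁
  have hx₁r : (1 : ℝ) ≤ x₁ := by exact_mod_cast hx₁1
  -- logarithms
  have hlogyr : Real.log yr = (1 + ε) / 2 * l := by rw [hyr, Real.log_rpow hq0]
  have hlogY : Real.log Y ≤ (1 + ε) * l := by
    have h1 : Real.log Y ≤ Real.log yr := Real.log_le_log hYr0 hYle
    rw [hlogyr] at h1
    have h2 : (1 + ε) / 2 * l ≤ (1 + ε) * l :=
      mul_le_mul_of_nonneg_right (by linarith only [hε]) hl0.le
    linarith only [h1, h2]
  have hlogY0 : 0 ≤ Real.log Y := Real.log_nonneg (by linarith only [hY4])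
  have hlogx₁ : Real.log x₁ ≤ Real.log x := Real.log_le_log (by linarith only [hx₁r]) hx1le
  have hlogx₁0 : 0 ≤ Real.log x₁ := Real.log_nonneg hx₁r
  have hlogx : l ≤ 2 * Real.log x := by
    have h1 : Real.log yr ≤ Real.log x := Real.log_le_log hyr0 hxyr
    rw [hlogyr] at h1
    have h2 : l ≤ 2 * ((1 + ε) / 2 * l) := by nlinarith only [hl0.le, hε.le]
    linarith only [h1, h2]
  have hlogx0 : 0 < Real.log x := by linarith only [hlogx, hl0]
  -- the window bound `W = √q (1 + log q) ≤ Y`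
  set W : ℝ := Real.sqrt q * (1 + l) with hWdef
  have hW : ∀ N n : ℕ, ‖∑ k ∈ Ioc N n, χ (k : ZMod q)‖ ≤ W := fun N n =>
    CharacterTails.norm_window_le_polyaVinogradov χ hprim hq2 N n
  have hsqrtq1 : 1 ≤ Real.sqrt q := by
    have h := Real.sqrt_le_sqrt hq1
    rwa [Real.sqrt_one] at h
  have hW1 : 1 ≤ W := one_le_mul_of_one_le_of_one_le hsqrtq1 (by linarith only [hl0])
  have hW0 : 0 < W := by linarith only [hW1]
  have hWY : W ≤ Y := by linarith only [hWyr, hYhalf]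
  -- the cut `y₀ = ⌊√(W Y)⌋`, `2 ≤ y₀ ≤ Y`, and `s = √(W/Y)`
  set ρ : ℝ := Real.sqrt (W * Y) with hρdef
  set y₀ : ℕ := ⌊ρ⌋₊ with hy₀def
  set s : ℝ := Real.sqrt (W / Y) with hsdef
  have hρ0 : 0 < ρ := Real.sqrt_pos.mpr (by positivity)
  have hρ2 : 2 ≤ ρ := by
    rw [hρdef, show (2 : ℝ) = Real.sqrt 4 by
      rw [show (4 : ℝ) = 2 ^ 2 by norm_num, Real.sqrt_sq (by norm_num)]]
    refine Real.sqrt_le_sqrt ?_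
    calc (4 : ℝ) = 1 * 4 := by norm_num
      _ ≤ W * Y := mul_le_mul hW1 hY4 (by norm_num) hW0.le
  have hρY : ρ ≤ Y := by
    rw [hρdef, Real.sqrt_le_left hYr0.le, sq]
    exact mul_le_mul_of_nonneg_right hWY hYr0.le
  have hy₀2 : 2 ≤ y₀ := Nat.le_floor (by exact_mod_cast hρ2)
  have hy₀Y : y₀ ≤ Y := by
    rw [hy₀def]; exact (Nat.floor_le_floor hρY).trans_eq (Nat.floor_natCast Y)
  have hy₀le : (y₀ : ℝ) ≤ ρ := Nat.floor_le hρ0.le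
  have hy₀lt : ρ < y₀ + 1 := by
    have := Nat.lt_floor_add_one ρ
    rw [← hy₀def] at this; exact_mod_cast this
  have hs0 : 0 ≤ s := Real.sqrt_nonneg _
  obtain ⟨hρs, hWs⟩ := sqrt_mul_facts hW0 hYr0
  rw [← hρdef, ← hsdef] at hρs hWs
  have hWs' : W ≤ s * (y₀ + 1) := by
    rw [hWs]; exact mul_le_mul_of_nonneg_left hy₀lt.le hs0
  have hys' : (y₀ : ℝ) ≤ s * Y := by rw [← hρs]; exact hy₀le
  -- `s ≤ √2 (1 + l) q^{-ε/4}`, `3 s ≤ L₁`, `E₀ ≤ L₁ l / 4` (the two uses of Siegel's theorem)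
  have hs_le : s ≤ Real.sqrt 2 * (1 + l) * (q : ℝ) ^ (-(ε / 4)) :=
    sqrt_window_div_le (by omega) ε hYhalf
  have h3s : 3 * s ≤ L₁ := by linarith only [hs_le, hS1, hL₁S]
  set E₀ : ℝ := (3 * (1 + Real.log Y) + 2) * s with hE₀def
  have hE₀0 : 0 ≤ E₀ := mul_nonneg (by linarith only [hlogY0]) hs0
  have hE₀ : E₀ ≤ L₁ * l / 4 := by
    have h1 : 3 * (1 + Real.log Y) + 2 ≤ 5 * (1 + ε) * (1 + l) := by
      nlinarith only [hlogY, hε.le, hl0.le]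
    have h2 : E₀ ≤ 5 * (1 + ε) * (1 + l) * (Real.sqrt 2 * (1 + l) * (q : ℝ) ^ (-(ε / 4))) :=
      mul_le_mul h1 hs_le hs0 (by positivity)
    have h3 : 5 * (1 + ε) * (1 + l) * (Real.sqrt 2 * (1 + l) * (q : ℝ) ^ (-(ε / 4))) =
        5 * Real.sqrt 2 * (1 + ε) * (1 + l) ^ 2 * (q : ℝ) ^ (-(ε / 4)) := by ring
    rw [h3] at h2
    have h4 : L₁ / 8 ≤ L₁ * l / 4 := by nlinarith only [hL₁0.le, hlhalf.le]
    linarith only [h2, hS2, hL₁S, h4]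
  -- (A) one exceptional prime times `n ≤ Y`; (B) the mean values at `Y` and `Y x₁`
  have hA := sum_mul_sum_excPrimes_le χ hsq hY1 hYx₁
  have hYx₁' : Y ≤ Y * x₁ := Nat.le_mul_of_pos_right Y (by omega)
  have hEY := abs_sub_main_le_of_cut χ hne hsq hW hy₀2 hy₀Y le_rfl hs0 hWs' hys'
  have hEYX := abs_sub_main_le_of_cut χ hne hsq hW hy₀2 hy₀Y hYx₁' hs0 hWs' hys'
  have hYx₁r : ((Y * x₁ : ℕ) : ℝ) = (Y : ℝ) * x₁ := by push_cast; ring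
  have hlogYX : Real.log ((Y * x₁ : ℕ) : ℝ) = Real.log Y + Real.log x₁ := by
    rw [hYx₁r, Real.log_mul hYr0.ne' (by linarith only [hx₁r])]
  rw [hlogYX] at hEYX
  rw [← hL₁def, ← hM₁def] at hEY hEYX
  set SY : ℝ := ∑ n ∈ Icc 1 Y, (χ.zetaMul n).re / n with hSYdef
  set SYX : ℝ := ∑ n ∈ Icc 1 (Y * x₁), (χ.zetaMul n).re / n with hSYXdef
  set P : ℝ := ∑ p ∈ excPrimes χ (Ioc Y x₁), (1 : ℝ) / p with hPdef
  -- upper bound for the window, lower bound for `S(Y)`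
  have hγ0 : 0 < Real.eulerMascheroniConstant :=
    lt_trans (by norm_num) Real.one_half_lt_eulerMascheroniConstant
  have hupper : SYX - SY ≤ 3 * L₁ * Real.log x := by
    have h1 := (abs_le.mp hEYX).2
    have h2 := (abs_le.mp hEY).1
    have h3 : 3 * s * Real.log x₁ ≤ L₁ * Real.log x := by
      calc 3 * s * Real.log x₁ ≤ L₁ * Real.log x₁ := mul_le_mul_of_nonneg_right h3s hlogx₁0
        _ ≤ L₁ * Real.log x := mul_le_mul_of_nonneg_left hlogx₁ hL₁0.le
    have h4 : L₁ * Real.log x₁ ≤ L₁ * Real.log x := mul_le_mul_of_nonneg_left hlogx₁ hL₁0.le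
    have h5 : L₁ * l ≤ L₁ * (2 * Real.log x) := mul_le_mul_of_nonneg_left hlogx hL₁0.le
    have h6 : (3 * (1 + (Real.log Y + Real.log x₁)) + 2) * s = E₀ + 3 * s * Real.log x₁ := by
      rw [hE₀def]; ring
    rw [h6] at h1
    linarith only [h1, h2, h3, h4, h5, hE₀]
  have hlower : L₁ * η * l / 4 ≤ SY := by
    have h2 := (abs_le.mp hEY).1
    have h3 : 0 ≤ (Real.log Y + Real.eulerMascheroniConstant) * L₁ :=
      mul_nonneg (by linarith only [hlogY0, hγ0]) hL₁0.le
    have h4 : L₁ * l * 1 ≤ L₁ * l * η := mul_le_mul_of_nonneg_left hη1 (mul_pos hL₁0 hl0).le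
    linarith only [h2, h3, hM₁, hE₀, h4]
  have hden : 0 < L₁ * η * l / 4 := by positivity
  have hSY0 : 0 < SY := lt_of_lt_of_le hden hlower
  -- conclusion: `P ≤ (SYX − SY)/SY ≤ 12 log x/(η log q)`
  have hPle : P ≤ (SYX - SY) / SY := by
    rw [le_div_iff₀ hSY0]
    linarith only [hA]
  calc P ≤ (SYX - SY) / SY := hPle
    _ ≤ 3 * L₁ * Real.log x / (L₁ * η * l / 4) :=
        div_le_div₀ (by positivity) hupper hden hlower
    _ = 12 * (Real.log x / l) / η := by
        field_simp
        ring

end Literature.NumberTheory.LFunctions.SiegelZero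

end
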